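import Literature.Probability.LatticeModels.TorusFourier
import HarnessLib

/-!
# Riemann sums of periodic Lipschitz functions over the momentum grid: an explicit rate

Topic `Probability/LatticeModels`; companion of `BrillouinRiemannSum.lean`
(`tendsto_cornerRiemannSum`: Riemann sums of CONTINUOUS functions over the grid `(2π/L)(ℤ/L)^d`
converge to the zone integral, without a rate). Error ESTIMATES for finite-volume lattice models
want a RATE, and the textbook one is elementary: the compound rectangle rule on an integrand with
modulus of continuity `ω` errs by at most `(b - a)·ω(h)` (Davis–Rabinowitz 1984, §2.1 eq. (2.1.6);
Faul 2016, §5: composite midpoint rule, product rules over rectangles); for a `K`-Lipschitz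
integrand and midpoint nodes this is `(b - a)·K h/2`, and for a PERIODIC integrand over a full
period the left-endpoint grid `{jh}` IS a midpoint grid after shifting the window by `h/2` (the
integral over a period does not depend on the window: Mathlib
`Function.Periodic.intervalIntegral_add_eq`). PROVED here, in dimension one and two, with the
momentum grid of the discrete torus `(ℤ/L)²` (`latticeMomentum`, `TorusFourier.lean`; the
reciprocal torus of Friedli–Velenik §10.5.2) as the application:

* `abs_riemannSum_sub_integral_le` — `g` `T`-periodic, `|g x − g y| ≤ K|x − y|`, `h = T/L`:
  `|h Σ_{j<L} g(jh) − ∫_a^{a+T} g| ≤ K T h/2`;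
* `abs_riemannSum_two_sub_integral_le` — `f` `2π`-periodic and `K`-Lipschitz in each variable
  separately, `h = 2π/L`: `|h² Σ_{j,k<L} f(jh, kh) − ∫_{-π}^{π}∫_{-π}^{π} f| ≤ 4π² K h`
  (the one-dimensional bound in `x` at every grid `y`, plus the one-dimensional bound for the
  `2πK`-Lipschitz section integral `y ↦ ∫ f(x, y) dx`);
* `sum_torusSite_two_eq_sum_range` (momentum sum = double sum over representatives) and the
  packaged torus form `abs_sum_torusSite_two_sub_integral_le`:
  `|Σ_{k ∈ (ℤ/L)²} f(p_k) − L²/(4π²) ∫∫ f| ≤ 2π K L`.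

Used by `Summits/HubbardSuperconductivity/HubbardLadder/Bounds/HalfBathtubStiffnessBoundTL.lean`
(thermodynamic limit of the half-bathtub stiffness ceiling with rate `O(1/L)`).

## Mathlib / tree search

Mathlib has no compound-rule error estimate (`lean search 'riemannSum|rectangle|midpoint_rule'`:
box-integral tagged partitions only); used here: `intervalIntegral.sum_integral_adjacent_intervals`,
`intervalIntegral.norm_integral_le_of_norm_le_const`, `Function.Periodic.intervalIntegral_add_eq`,
`LipschitzWith.of_dist_le_mul`. Tree: `BrillouinRiemannSum.lean` (qualitative, all `d`),
`LatticeGreenRiemannSum.lean` / `XYOrderRiemannSumProofs.lean` (two singular integrands);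
the one-dimensional modulus-of-continuity form of (2.1.6) for an arbitrary window (left endpoints,
constant `(b − a)·ω`, no periodicity) is `norm_riemannSum_sub_intervalIntegral_le` in
`Analysis/Distribution/SchwartzParameterIntegral.lean`, and a compact-support version on `Λ⁻¹ℤ^d`
is `LongRangePhi4.FRD.abs_riemannSum_sub_integral_le` in
`Barriers/CriticalPhenomena/RigorousRGSmallParameterRiemannSum.lean` (Slade, Lemma 5.2.2); what is
added here is the PERIODIC case (midpoint constant `K T h/2`, any window) and the packaging on the
reciprocal torus `(ℤ/L)²` indexed by `TorusSite 2 L` / `latticeMomentum`.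

## References

* P. J. Davis, P. Rabinowitz, *Methods of Numerical Integration*, 2nd ed. (Academic Press 1984),
  §2.1, eq. (2.1.6), p. 52: `|∫_a^b f − h Σ_{k=1}^{n} f(a + kh)| ≤ (b − a) ω((b − a)/n)` with `ω`
  the modulus of continuity (2.1.5); "for functions periodic over `[a, b]`, `T_n = R_n = R̄_n`".
  [DavisRabinowitz1984]
* A. C. Faul, *A Concise Introduction to Numerical Analysis* (CRC 2016), §5 (composite midpoint
  rule; product rules over rectangles). [Faul2016]
* S. Friedli, Y. Velenik, *Statistical Mechanics of Lattice Systems* (CUP 2017), §10.5.2 (the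
  reciprocal torus `(2π/L){0,…,L-1}^d`; momentum sums as Riemann sums, (10.41)).
  [FriedliVelenikSMLS2017]
-/

noncomputable section

namespace Literature.Probability.LatticeModels

open MeasureTheory Finset Real

/-! ### One dimension -/

/-- A function with a real Lipschitz bound `|g x − g y| ≤ K|x − y|`, `0 ≤ K`, is continuous
(Mathlib `LipschitzWith.continuous`, real-valued packaging). [folklore] -/
private theorem continuous_of_abs_sub_le {g : ℝ → ℝ} {K : ℝ} (hK : 0 ≤ K)
    (hlip : ∀ x y, |g x - g y| ≤ K * |x - y|) : Continuous g := by
  have h : LipschitzWith K.toNNReal g := LipschitzWith.of_dist_le_mul fun x y => by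
    rw [Real.dist_eq, Real.dist_eq, Real.coe_toNNReal K hK]
    exact hlip x y
  exact h.continuous

/-- One centred cell of the midpoint rule for a `K`-Lipschitz function:
`|h · g(c) − ∫_{c-h/2}^{c+h/2} g| ≤ K (h/2) h` — the case `n = 1` of Davis–Rabinowitz (2.1.6)
`|∫_a^b f − h Σ f(a + kh)| ≤ (b − a) ω(h)` with the node at the midpoint, `ω(h/2) ≤ K h/2`.
[cite: DavisRabinowitz1984, §2.1 eq. (2.1.6)] -/
theorem abs_mul_sub_integral_cell_le {g : ℝ → ℝ} {K : ℝ} (hK : 0 ≤ K)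
    (hlip : ∀ x y, |g x - g y| ≤ K * |x - y|) (c : ℝ) {h : ℝ} (hh : 0 ≤ h) :
    |h * g c - ∫ x in (c - h / 2)..(c + h / 2), g x| ≤ K * (h / 2) * h := by
  have hcont : Continuous g := continuous_of_abs_sub_le hK hlip
  have hconst : h * g c = ∫ _ in (c - h / 2)..(c + h / 2), g c := by
    rw [intervalIntegral.integral_const, smul_eq_mul]; ring
  rw [hconst,
    ← intervalIntegral.integral_sub intervalIntegrable_const (hcont.intervalIntegrable _ _)]
  have hbound : ∀ x ∈ Set.uIoc (c - h / 2) (c + h / 2), ‖g c - g x‖ ≤ K * (h / 2) := by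
    intro x hx
    rw [Set.uIoc_of_le (by linarith)] at hx
    rw [Real.norm_eq_abs]
    refine (hlip c x).trans (mul_le_mul_of_nonneg_left ?_ hK)
    rw [abs_le]
    constructor <;> linarith [hx.1, hx.2]
  have := intervalIntegral.norm_integral_le_of_norm_le_const hbound
  rw [Real.norm_eq_abs, show c + h / 2 - (c - h / 2) = h by ring, abs_of_nonneg hh] at this
  exact this

/-- **Rectangle rule over one period of a periodic Lipschitz function.** For `g` `T`-periodic with
`|g x − g y| ≤ K|x − y|`, `0 < L`, `h = T/L` and any window `[a, b]`, `b = a + T`: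
`|h Σ_{j<L} g(jh) − ∫_a^b g| ≤ K T h / 2`. This is Davis–Rabinowitz (2.1.6),
`|∫_a^b f − h Σ_{k=1}^{n} f(a + kh)| ≤ n h ω(h) = (b − a) ω((b − a)/n)` (p. 52), specialised to
`ω(δ) ≤ Kδ` and a PERIODIC integrand, for which left-, right-endpoint and trapezoidal sums coincide
(loc. cit.: "for functions periodic over `[a, b]`, `T_n = R_n = R̄_n`") and the window may be
shifted to the centred cells `[jh − h/2, jh + h/2]`, giving the midpoint constant `ω(h/2) = K h/2`.
[cite: DavisRabinowitz1984, §2.1 eq. (2.1.6)] -/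
theorem abs_riemannSum_sub_integral_le {g : ℝ → ℝ} {K T : ℝ} (hK : 0 ≤ K) (hT : 0 < T)
    (hper : Function.Periodic g T) (hlip : ∀ x y, |g x - g y| ≤ K * |x - y|)
    {L : ℕ} (hL : 0 < L) {a b : ℝ} (hab : b = a + T) :
    |T / L * ∑ j ∈ Finset.range L, g (j * (T / L)) - ∫ x in a..b, g x| ≤
      K * T * (T / L) / 2 := by
  subst hab
  set h := T / L with hh_def
  have hL' : (0 : ℝ) < L := Nat.cast_pos.2 hL
  have hh : 0 < h := div_pos hT hL'
  have hLh : (L : ℝ) * h = T := by rw [hh_def]; field_simp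
  have hcont : Continuous g := continuous_of_abs_sub_le hK hlip
  rw [hper.intervalIntegral_add_eq a (-(h / 2))]
  have hadj := intervalIntegral.sum_integral_adjacent_intervals (f := g) (μ := volume)
    (a := fun j : ℕ => -(h / 2) + (j : ℝ) * h) (n := L) fun k _ => hcont.intervalIntegrable _ _
  simp only [Nat.cast_zero, zero_mul, add_zero] at hadj
  rw [hLh] at hadj
  rw [← hadj, Finset.mul_sum, ← Finset.sum_sub_distrib]
  calc |∑ j ∈ Finset.range L, (h * g (j * h) -
          ∫ x in (-(h / 2) + (j : ℝ) * h)..(-(h / 2) + ((j + 1 : ℕ) : ℝ) * h), g x)|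
      ≤ ∑ j ∈ Finset.range L, |h * g (j * h) -
          ∫ x in (-(h / 2) + (j : ℝ) * h)..(-(h / 2) + ((j + 1 : ℕ) : ℝ) * h), g x| :=
        Finset.abs_sum_le_sum_abs _ _
    _ ≤ ∑ _j ∈ Finset.range L, K * (h / 2) * h := Finset.sum_le_sum fun j _ => by
        rw [show -(h / 2) + (j : ℝ) * h = j * h - h / 2 by ring,
          show -(h / 2) + ((j + 1 : ℕ) : ℝ) * h = j * h + h / 2 by push_cast; ring]
        exact abs_mul_sub_integral_cell_le hK hlip _ hh.le
    _ = K * T * h / 2 := by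
        rw [Finset.sum_const, Finset.card_range, nsmul_eq_mul, ← hLh]; ring

/-! ### Two dimensions: the Brillouin torus `[-π, π]²` -/

/-- **Two-dimensional rectangle rule over the Brillouin torus.** For `f` `2π`-periodic and
`K`-Lipschitz in each variable separately, `0 < L`, `h = 2π/L`:
`|h² Σ_{k<L} Σ_{j<L} f(jh, kh) − ∫_{-π}^{π}∫_{-π}^{π} f(x, y) dx dy| ≤ 4π² K h` (the one-dimensional
bound (2.1.6) in `x` at every grid `y`, plus (2.1.6) for the `2πK`-Lipschitz section integral
`y ↦ ∫ f(x, y) dx`: the product rule over the square).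
[cite: DavisRabinowitz1984, §2.1 eq. (2.1.6)] -/
theorem abs_riemannSum_two_sub_integral_le {f : ℝ → ℝ → ℝ} {K : ℝ} (hK : 0 ≤ K)
    (hperx : ∀ y, Function.Periodic (fun x => f x y) (2 * π))
    (hpery : ∀ x, Function.Periodic (f x) (2 * π))
    (hlipx : ∀ x x' y, |f x y - f x' y| ≤ K * |x - x'|)
    (hlipy : ∀ x y y', |f x y - f x y'| ≤ K * |y - y'|) {L : ℕ} (hL : 0 < L) :
    |(2 * π / L) ^ 2 * ∑ k ∈ Finset.range L, ∑ j ∈ Finset.range L,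
        f (j * (2 * π / L)) (k * (2 * π / L)) - ∫ y in (-π)..π, ∫ x in (-π)..π, f x y| ≤
      4 * π ^ 2 * K * (2 * π / L) := by
  set h := 2 * π / L with hh_def
  have hπ := Real.pi_pos
  have hT : (0 : ℝ) < 2 * π := by positivity
  have hL' : (0 : ℝ) < L := Nat.cast_pos.2 hL
  have hh : 0 < h := div_pos hT hL'
  have hLeq : (L : ℝ) = 2 * π / h := by rw [hh_def]; field_simp
  set F : ℝ → ℝ := fun y => ∫ x in (-π)..π, f x y with hF_def
  have hFper : Function.Periodic F (2 * π) := fun y => by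
    simp only [hF_def]
    exact intervalIntegral.integral_congr fun x _ => hpery x y
  have hFlip : ∀ y y', |F y - F y'| ≤ 2 * π * K * |y - y'| := by
    intro y y'
    have hcy : Continuous fun x => f x y := continuous_of_abs_sub_le hK fun x x' => hlipx x x' y
    have hcy' : Continuous fun x => f x y' :=
      continuous_of_abs_sub_le hK fun x x' => hlipx x x' y'
    simp only [hF_def]
    rw [← intervalIntegral.integral_sub (hcy.intervalIntegrable _ _) (hcy'.intervalIntegrable _ _)]
    have hb : ∀ x ∈ Set.uIoc (-π) π, ‖f x y - f x y'‖ ≤ K * |y - y'| := fun x _ => by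
      rw [Real.norm_eq_abs]; exact hlipy x y y'
    have := intervalIntegral.norm_integral_le_of_norm_le_const hb
    rw [Real.norm_eq_abs, show π - -π = 2 * π by ring, abs_of_pos hT] at this
    linarith
  set S : ℕ → ℝ := fun k => ∑ j ∈ Finset.range L, f (j * h) (k * h) with hS_def
  have h1 : ∀ k ∈ Finset.range L, |h * S k - F (k * h)| ≤ K * (2 * π) * h / 2 := fun k _ =>
    abs_riemannSum_sub_integral_le hK hT (hperx (k * h)) (fun x x' => hlipx x x' (k * h)) hL
      (by ring)
  have h2 : |h * ∑ k ∈ Finset.range L, F (k * h) - ∫ y in (-π)..π, F y| ≤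
      2 * π * K * (2 * π) * h / 2 :=
    abs_riemannSum_sub_integral_le (by positivity) hT hFper hFlip hL (by ring)
  have hsplit : h ^ 2 * ∑ k ∈ Finset.range L, S k - ∫ y in (-π)..π, F y =
      h * ∑ k ∈ Finset.range L, (h * S k - F (k * h)) +
        (h * ∑ k ∈ Finset.range L, F (k * h) - ∫ y in (-π)..π, F y) := by
    rw [Finset.sum_sub_distrib, ← Finset.mul_sum]; ring
  rw [hsplit]
  calc |h * ∑ k ∈ Finset.range L, (h * S k - F (k * h)) +
          (h * ∑ k ∈ Finset.range L, F (k * h) - ∫ y in (-π)..π, F y)|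
      ≤ |h * ∑ k ∈ Finset.range L, (h * S k - F (k * h))| +
          |h * ∑ k ∈ Finset.range L, F (k * h) - ∫ y in (-π)..π, F y| := abs_add_le _ _
    _ ≤ h * ∑ _k ∈ Finset.range L, K * (2 * π) * h / 2 + 2 * π * K * (2 * π) * h / 2 := by
        refine add_le_add ?_ h2
        rw [abs_mul, abs_of_pos hh]
        exact mul_le_mul_of_nonneg_left
          ((Finset.abs_sum_le_sum_abs _ _).trans (Finset.sum_le_sum h1)) hh.le
    _ = 4 * π ^ 2 * K * h := by
        rw [Finset.sum_const, Finset.card_range, nsmul_eq_mul, hLeq]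
        field_simp
        ring

/-! ### The momentum grid of the discrete torus `(ℤ/L)²` -/

/-- Reindexing `ℤ/L` by the representatives `0, …, L-1`:
`Σ_{a ∈ ℤ/L} G(2π a/L) = Σ_{j<L} G(j · 2π/L)` — the reciprocal torus
`T*_L = {(2π/L) n : 0 ≤ nᵢ < L}` of Friedli–Velenik, one coordinate.
[cite: FriedliVelenikSMLS2017, §10.5.2 (reciprocal torus)] -/
theorem sum_zmod_angle_eq_sum_range (G : ℝ → ℝ) (L : ℕ) [NeZero L] :
    ∑ a : ZMod L, G (2 * π * (a.val : ℝ) / L) = ∑ j ∈ Finset.range L, G (j * (2 * π / L)) := by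
  refine Finset.sum_nbij' (fun a : ZMod L => a.val) (fun j : ℕ => (j : ZMod L)) ?_ ?_ ?_ ?_ ?_
  · intro a _; exact Finset.mem_range.2 (ZMod.val_lt a)
  · intro j _; exact Finset.mem_univ _
  · intro a _; exact ZMod.natCast_zmod_val a
  · intro j hj; exact ZMod.val_cast_of_lt (Finset.mem_range.1 hj)
  · intro a _; congr 1; ring

/-- The momentum sum over the discrete torus `(ℤ/L)²` (momenta `latticeMomentum L k i = 2π kᵢ/L`
with representatives `kᵢ ∈ {0, …, L-1}`: the reciprocal torus `T*_L = {(2π/L)(n₁, n₂) : 0 ≤ nᵢ < L}`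
of Friedli–Velenik) as a double sum over representatives.
[cite: FriedliVelenikSMLS2017, §10.5.2 (reciprocal torus)] -/
theorem sum_torusSite_two_eq_sum_range (F : ℝ → ℝ → ℝ) (L : ℕ) [NeZero L] :
    ∑ k : TorusSite 2 L, F (latticeMomentum L k 0) (latticeMomentum L k 1) =
      ∑ b ∈ Finset.range L, ∑ a ∈ Finset.range L, F (a * (2 * π / L)) (b * (2 * π / L)) := by
  calc ∑ k : TorusSite 2 L, F (latticeMomentum L k 0) (latticeMomentum L k 1)
      = ∑ a : ZMod L, ∑ b : ZMod L, F (2 * π * (a.val : ℝ) / L) (2 * π * (b.val : ℝ) / L) := by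
        rw [Fintype.sum_equiv (piFinTwoEquiv fun _ => ZMod L)
          (fun k : TorusSite 2 L => F (latticeMomentum L k 0) (latticeMomentum L k 1))
          (fun ab : ZMod L × ZMod L =>
            F (2 * π * (ab.1.val : ℝ) / L) (2 * π * (ab.2.val : ℝ) / L))
          fun k => rfl, Fintype.sum_prod_type]
    _ = ∑ b : ZMod L, ∑ a : ZMod L, F (2 * π * (a.val : ℝ) / L) (2 * π * (b.val : ℝ) / L) :=
        Finset.sum_comm
    _ = ∑ b : ZMod L, ∑ a ∈ Finset.range L, F (a * (2 * π / L)) (2 * π * (b.val : ℝ) / L) :=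
        Finset.sum_congr rfl fun b _ =>
          sum_zmod_angle_eq_sum_range (fun x => F x (2 * π * (b.val : ℝ) / L)) L
    _ = ∑ b ∈ Finset.range L, ∑ a ∈ Finset.range L, F (a * (2 * π / L)) (b * (2 * π / L)) :=
        sum_zmod_angle_eq_sum_range (fun y => ∑ a ∈ Finset.range L, F (a * (2 * π / L)) y) L

/-- **Momentum sums against zone integrals, with rate.** For `f` `2π`-periodic and `K`-Lipschitz
in each variable separately and `L ≥ 1`:
`|Σ_{k ∈ (ℤ/L)²} f(p_k) − L²/(4π²) ∫_{-π}^{π}∫_{-π}^{π} f| ≤ 2π K L` — the momentum sum over the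
reciprocal torus IS a Riemann sum (Friedli–Velenik §10.5.2, (10.41)), and Davis–Rabinowitz (2.1.6)
prices it; the quantitative companion of `tendsto_cornerRiemannSum` in `d = 2`.
[cite: DavisRabinowitz1984, §2.1 eq. (2.1.6)] -/
theorem abs_sum_torusSite_two_sub_integral_le {f : ℝ → ℝ → ℝ} {K : ℝ} (hK : 0 ≤ K)
    (hperx : ∀ y, Function.Periodic (fun x => f x y) (2 * π))
    (hpery : ∀ x, Function.Periodic (f x) (2 * π))
    (hlipx : ∀ x x' y, |f x y - f x' y| ≤ K * |x - x'|)
    (hlipy : ∀ x y y', |f x y - f x y'| ≤ K * |y - y'|) (L : ℕ) [NeZero L] :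
    |∑ k : TorusSite 2 L, f (latticeMomentum L k 0) (latticeMomentum L k 1) -
        (L : ℝ) ^ 2 / (4 * π ^ 2) * ∫ y in (-π)..π, ∫ x in (-π)..π, f x y| ≤ 2 * π * K * L := by
  have hL : 0 < L := Nat.pos_of_ne_zero (NeZero.ne L)
  have hL' : (0 : ℝ) < L := Nat.cast_pos.2 hL
  have hπ := Real.pi_pos
  have h2 := abs_riemannSum_two_sub_integral_le hK hperx hpery hlipx hlipy hL
  rw [← sum_torusSite_two_eq_sum_range f L] at h2
  set S := ∑ k : TorusSite 2 L, f (latticeMomentum L k 0) (latticeMomentum L k 1)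
  set I := ∫ y in (-π)..π, ∫ x in (-π)..π, f x y
  have hc : (0 : ℝ) < (L : ℝ) ^ 2 / (4 * π ^ 2) := by positivity
  have key : S - (L : ℝ) ^ 2 / (4 * π ^ 2) * I =
      (L : ℝ) ^ 2 / (4 * π ^ 2) * ((2 * π / L) ^ 2 * S - I) := by
    field_simp
    ring
  have key2 : (L : ℝ) ^ 2 / (4 * π ^ 2) * (4 * π ^ 2 * K * (2 * π / L)) = 2 * π * K * L := by
    field_simp
  rw [key, abs_mul, abs_of_pos hc, ← key2]
  exact mul_le_mul_of_nonneg_left h2 hc.le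

end Literature.Probability.LatticeModels
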